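import Literature.Analysis.FluidPDE.Ferrari1993Continuation
import Literature.Analysis.FluidPDE.KatoLaiPeriodicCylinderProofs
import Literature.Analysis.FunctionSpaces.MeyersSerrinProofs
import HarnessLib

/-!
# Kato–Lai local existence in the periodic cylinder: the smooth-data corollaries of the
uniform-time fact; the BKM chain on two analytic facts

Topic `Literature/Analysis/FluidPDE`. The tree carries Kato–Lai 1984, Thm I/II (T. Kato,
C. Y. Lai, *Nonlinear evolution equations and the Euler flow*, J. Funct. Anal. **56** (1984)
15–28, p. 17) transported to the periodic cylinder `{r ≤ 1} × ℝ/Lℤ` as **one** named existence fact,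

* `KatoLai1984_periodicCylinderUniformExistence` (`Ferrari1993Continuation.lean`): data `C^∞` on
  the closed cylinder with `H³` norm at most `M` on the period cell launch a solution of the
  periodic class on `[0, T₁)`, `T₁ = T₁(L, M)` — Thm I with its printed uniformity clause "`T` and
  `K` may be chosen depending only on `Φ_{s₀}`" (`s₀ = [m/2] + 2 = 3`, `f = 0`) and Thm II
  ("`u(t) ∈ C^∞(Ω̄)` if `φ` and `f(t)` are"),

together with the uniqueness clause of Thm I, `KatoLai1984_periodicCylinderUniqueness`
(`KatoLaiPeriodicCylinder.lean`), **discharged** (`KatoLai1984_periodicCylinderUniqueness_holds`,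
`KatoLaiPeriodicCylinderProofs.lean`).

This file **proves** from the uniform-time fact its two smooth-data corollaries, with their
statements written out (one printed theorem, one named fact: the earlier renderings
`KatoLai1984_periodicCylinderSmoothExistence` — globally smooth data, no size control — and
`KatoLai1984_periodicCylinderLocalExistence` — the same in the axisymmetric class — of the same
printed theorem are superseded by these implications and retired as named facts, D-0026):

* `KatoLai1984_periodicCylinderSmoothExistence_of_uniformExistence`: a smooth velocity field on
  `ℝ³`, `L`-periodic in `z`, divergence free in `{r < 1}` and tangential on `{r = 1}`, launches for
  some `T > 0` a solution of the periodic class `IsPeriodicCylinderEulerSolution L [0, T) u₀`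
  (classical Euler solution in `{r < 1}` with the slip condition, `u(0) = u₀`, `C^∞` up to the
  boundary jointly in `(t, x)`, `L`-periodic velocity and pressure);
* `KatoLai1984_periodicCylinderLocalExistence_of_uniformExistence`: for axisymmetric such data, a
  solution of the axisymmetric class `IsCylinderEulerSolution L [0, T) u₀`
  (`ChenHouContinuationProofs.lean`) — through the symmetry propagation by uniqueness
  `KatoLai1984_periodicCylinderLocalExistence_of_existence_of_uniqueness` of
  `KatoLaiPeriodicCylinder.lean`; this is the local-existence input of the maximal-solution
  argument `Ferrari1993_periodicCylinderEulerBKM_of_localExistence_of_continuation`,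

and feeds the discharged uniqueness into the assemblies of `Ferrari1993Continuation.lean` and
`ChenHouContinuationProofs.lean`: the continuation fact, the BKM criterion in the periodic cylinder
and the Chen–Hou blow-up rest on exactly two analytic named facts of the Kato–Lai/Ferrari theory —
the a-priori `H³` bound `Ferrari1993_periodicCylinderH3Bound` and the uniform-time existence
`KatoLai1984_periodicCylinderUniformExistence` — plus, for the blow-up, Chen–Hou's own estimates
(`Ferrari1993_periodicCylinderContinuation_of_H3Bound_of_uniformExistence`,
`Ferrari1993_periodicCylinderEulerBKM_of_H3Bound_of_uniformExistence`,
`chen_hou_blowup_of_H3Bound_of_uniformExistence`).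

The only analysis in the passage to the corollaries is the remark recorded in
`Ferrari1993Continuation.lean`: a field which is `C^∞` on the closed cylinder has **finite**
`H³ = W^{3,2}` norm on the open period cell (`eSobolevDomainNorm_cylinderCell_lt_top`), so it is
admissible for the uniform-time fact with `M` its own norm. That finiteness is proved here for every
order `k` and exponent `p` from the tree's Sobolev calculus (`MeyersSerrin.eSobolevDomainNorm_succ_eq`:
the infimum in the norm is attained at any weak derivative; `MeyersSerrin.hasWeakFDerivOn_of_contDiffOn`:
smooth functions are weakly differentiable with the classical derivative) by induction on `k`,
differentiating *within* the closed cylinder (a convex set of unique differentiability,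
`uniqueDiffOn_closure_unitCylinder`, on which `fderivWithin` of a `C^∞` function is again `C^∞`,
and agrees with `fderiv` on the open cell) and bounding continuous functions on the compact closed
cell (`eSobolevDomainNorm_lt_top_of_contDiffOn`, stated for any set `C ⊇ closure Ω` of unique
differentiability with `closure Ω` compact, in a finite-dimensional space with an additive Haar
measure).

Nothing here discharges `KatoLai1984_periodicCylinderUniformExistence` itself: that is Kato–Lai's
`H^s` theory in a domain with curved boundary (Sobolev spaces up to the boundary, the Helmholtz
projection on `H^s`, Neumann elliptic regularity, the abstract Thm A `KatoLai1984_thmA` of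
`KatoLaiAbstractEvolution.lean`), absent from Mathlib and the tree.

Mathlib/tree search: `lean search 'eSobolevDomainNorm.*lt_top'` — only
`eSobolevDomainNorm_one_lt_top` (from `MemSobolevDomain 1`) and `eSobolevDomainNorm_lt_top_iff_holds`;
no finiteness statement for smooth functions on bounded domains;
`lean search 'UniformExistence'` — `Ferrari1993Continuation.lean` only; no other local existence
theorem for `IsPeriodicCylinderEulerSolution` / `IsCylinderEulerSolution`. Used:
`contDiffOn_infty_iff_fderivWithin`, `fderivWithin_of_mem_nhds`,
`IsCompact.exists_bound_of_continuousOn`, `MemLp.of_bound`, `EuclideanSpace.norm_eq`.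
-/

noncomputable section

open MeasureTheory Set Function Filter Topology TopologicalSpace WithLp
open scoped ContDiff NNReal ENNReal InnerProductSpace RealInnerProductSpace

namespace Literature.Analysis.FluidPDE

open Literature.Analysis.FunctionSpaces

/-! ### Finiteness of Sobolev norms of functions smooth up to the boundary -/

section SobolevOfSmooth

variable {E' : Type*} [NormedAddCommGroup E'] [NormedSpace ℝ E'] [FiniteDimensional ℝ E']
  [MeasurableSpace E'] [BorelSpace E'] {μ : Measure E'} [μ.IsAddHaarMeasure]
variable {F : Type*} [NormedAddCommGroup F] [NormedSpace ℝ F]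

omit [NormedSpace ℝ F] in
/-- A function continuous on a compact set `K` has finite `L^p` norm on every open `Ω ⊆ K`
(bounded function on a set of finite Haar measure). [folklore] -/
theorem eLpNorm_restrict_lt_top_of_continuousOn_isCompact {K : Set E'} (hK : IsCompact K)
    {Ω : Opens E'} (hΩK : (Ω : Set E') ⊆ K) {f : E' → F} (hf : ContinuousOn f K) (p : ℝ≥0∞) :
    eLpNorm f p (μ.restrict Ω) < ⊤ := by
  obtain ⟨R, hR⟩ := hK.exists_bound_of_continuousOn hf
  have hμ : μ Ω < ⊤ := (measure_mono hΩK).trans_lt hK.measure_lt_top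
  haveI : IsFiniteMeasure (μ.restrict Ω) := isFiniteMeasure_restrict.2 hμ.ne
  have hmeas : AEStronglyMeasurable f (μ.restrict Ω) :=
    (hf.mono hΩK).aestronglyMeasurable Ω.isOpen.measurableSet
  exact (MemLp.of_bound hmeas R
    (ae_restrict_of_forall_mem Ω.isOpen.measurableSet fun x hx => hR x (hΩK hx))).eLpNorm_lt_top

variable [CompleteSpace F]

/-- **Functions smooth up to the boundary have finite Sobolev norms of every order.** Let `C` be
a set of unique differentiability (e.g. a closed convex set with nonempty interior) and `Ω` an
open set with compact closure contained in `C`. If `f` is `C^∞` on `C`, then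
`‖f‖_{W^{k,p}(Ω)} < ∞` for all `k`, `p` (the tree's `eSobolevDomainNorm`, sum form via weak
derivatives). Induction on `k`: the infimum over weak derivatives in `‖f‖_{W^{k+1,p}(Ω)}` is
attained at the classical derivative (`MeyersSerrin.eSobolevDomainNorm_succ_eq` with
`MeyersSerrin.hasWeakFDerivOn_of_contDiffOn`), whose components agree on `Ω` with those of
`fderivWithin ℝ f C`, again `C^∞` on `C`; and continuous functions on the compact `closure Ω`
are bounded, hence in `L^p(Ω)` (the elementary inclusion `C^k(Ω̄) ⊂ W^{k,p}(Ω)` for bounded `Ω`).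
[folklore] -/
theorem eSobolevDomainNorm_lt_top_of_contDiffOn {C : Set E'} (hC : UniqueDiffOn ℝ C)
    {Ω : Opens E'} (hΩ : IsCompact (closure (Ω : Set E'))) (hΩC : closure (Ω : Set E') ⊆ C)
    (p : ℝ≥0∞) (k : ℕ) {f : E' → F} (hf : ContDiffOn ℝ ∞ f C) :
    eSobolevDomainNorm k p Ω μ f < ⊤ := by
  induction k generalizing f with
  | zero =>
    rw [eSobolevDomainNorm_zero]
    exact eLpNorm_restrict_lt_top_of_continuousOn_isCompact hΩ subset_closure
      (hf.continuousOn.mono hΩC) p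
  | succ k ih =>
    have hΩC' : (Ω : Set E') ⊆ C := subset_closure.trans hΩC
    have hfΩ : ContDiffOn ℝ ∞ f (Ω : Set E') := hf.mono hΩC'
    rw [MeyersSerrin.eSobolevDomainNorm_succ_eq (p := p) (k := k)
      (MeyersSerrin.hasWeakFDerivOn_of_contDiffOn (μ := μ) hfΩ)]
    refine ENNReal.add_lt_top.2 ⟨eLpNorm_restrict_lt_top_of_continuousOn_isCompact hΩ
      subset_closure (hf.continuousOn.mono hΩC) p, ?_⟩
    refine ENNReal.sum_lt_top.2 fun i _ => ?_
    -- the `i`-th component of `fderiv` agrees on `Ω` with that of `fderivWithin _ _ C`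
    have hD : ContDiffOn ℝ ∞ (fun x => fderivWithin ℝ f C x) C :=
      ((contDiffOn_infty_iff_fderivWithin hC).1 hf).2
    have hDi : ContDiffOn ℝ ∞ (fun x => fderivWithin ℝ f C x (Module.finBasis ℝ E' i)) C :=
      hD.clm_apply contDiffOn_const
    have hae : (fun x => fderiv ℝ f x (Module.finBasis ℝ E' i)) =ᵐ[μ.restrict Ω]
        fun x => fderivWithin ℝ f C x (Module.finBasis ℝ E' i) :=
      ae_restrict_of_forall_mem Ω.isOpen.measurableSet fun x hx => by
        show fderiv ℝ f x _ = fderivWithin ℝ f C x _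
        rw [fderivWithin_of_mem_nhds (mem_of_superset (Ω.isOpen.mem_nhds hx) hΩC')]
    rw [MeyersSerrin.eSobolevDomainNorm_congr_ae hae]
    exact ih hDi

end SobolevOfSmooth

/-! ### The period cell of the cylinder -/

/-- Points of the period cell have norm at most `√(1 + L²)`: `x₀² + x₁² < 1` and `0 < x₂ < L`.
[folklore] -/
theorem norm_le_of_mem_cylinderCell {L : ℝ} {x : EuclideanSpace ℝ (Fin 3)}
    (hx : x ∈ cylinderCell L) : ‖x‖ ≤ Real.sqrt (1 + L ^ 2) := by
  rw [mem_cylinderCell] at hx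
  obtain ⟨hr, hz0, hzL⟩ := hx
  have hr2 : x 0 ^ 2 + x 1 ^ 2 < 1 := by
    have h := cylRadius_sq x
    have h1 : cylRadius x ^ 2 < 1 := by
      have h0 := cylRadius_nonneg x
      nlinarith
    linarith
  have hz2 : x 2 ^ 2 ≤ L ^ 2 := by nlinarith
  rw [EuclideanSpace.norm_eq, Fin.sum_univ_three]
  simp only [Real.norm_eq_abs, sq_abs]
  exact Real.sqrt_le_sqrt (by linarith)

/-- The period cell is bounded, so its closure `{r ≤ 1} × [0, L]` is compact. [folklore] -/
theorem isCompact_closure_cylinderCell (L : ℝ) :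
    IsCompact (closure (cylinderCell L : Set (EuclideanSpace ℝ (Fin 3)))) := by
  refine (Metric.isBounded_iff_subset_closedBall (0 : EuclideanSpace ℝ (Fin 3))).2
    ⟨Real.sqrt (1 + L ^ 2), ?_⟩ |>.isCompact_closure
  intro x hx
  rw [Metric.mem_closedBall, dist_zero_right]
  exact norm_le_of_mem_cylinderCell hx

/-- The closed period cell lies in the closed cylinder. [folklore] -/
theorem closure_cylinderCell_subset (L : ℝ) :
    closure (cylinderCell L : Set (EuclideanSpace ℝ (Fin 3))) ⊆
      closure (unitCylinder : Set (EuclideanSpace ℝ (Fin 3))) :=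
  closure_mono (cylinderCell_le_unitCylinder L)

/-- **Fields smooth on the closed cylinder have finite Sobolev norms on the period cell**: if
`φ` is `C^∞` on `closure {r < 1}` then `‖φ‖_{W^{k,p}({r < 1} × (0, L))} < ∞` for all `k`, `p`; in
particular the `H³` size hypothesis of `KatoLai1984_periodicCylinderUniformExistence` is met by
every globally smooth datum with `M` its own norm (the remark
"`W^{3,2}` membership of `C^∞(Ω̄)` functions" of `Ferrari1993Continuation.lean`). [folklore] -/
theorem eSobolevDomainNorm_cylinderCell_lt_top {F : Type*} [NormedAddCommGroup F]
    [NormedSpace ℝ F] [CompleteSpace F] (L : ℝ) (k : ℕ) (p : ℝ≥0∞)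
    {φ : EuclideanSpace ℝ (Fin 3) → F}
    (hφ : ContDiffOn ℝ ∞ φ (closure (unitCylinder : Set (EuclideanSpace ℝ (Fin 3))))) :
    eSobolevDomainNorm k p (cylinderCell L) volume φ < ⊤ :=
  eSobolevDomainNorm_lt_top_of_contDiffOn uniqueDiffOn_closure_unitCylinder
    (isCompact_closure_cylinderCell L) (closure_cylinderCell_subset L) p k hφ

/-! ### The smooth-data corollaries of the uniform-time fact -/

/-- **Local existence of smooth Euler flows in the periodic cylinder, no symmetry, no size
control** (Kato–Lai 1984, Thm I, p. 17: for a bounded domain `Ω ⊂ ℝ^m` with smooth boundary,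
`s ≥ s₀ = [m/2] + 2`, `φ ∈ H^s_σ`, `f ∈ C([0,T₀]; H^s_σ)`, there are `T > 0` and a unique solution
`u ∈ C([0,T]; H^s_σ)` of `∂ₜu + P(u·∇)u = f`, `u(0) = φ`; Thm II, p. 17: `u(t) ∈ C^∞(Ω̄)` if `φ` and
`f(t)` are; quoted with the pressure as Ferrari 1993, Thm 1, p. 279), **from the uniform-time
fact** `KatoLai1984_periodicCylinderUniformExistence`: a smooth velocity field `u₀` on `ℝ³`,
`L`-periodic in `z` (`L > 0`), divergence free in `{r < 1}` and tangential on `{r = 1}`, launches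
for some `T > 0` a solution of the periodic class `IsPeriodicCylinderEulerSolution L [0, T) u₀`
(classical Euler solution in `{r < 1}` with the slip condition, `u(0) = u₀`, `C^∞` up to the
boundary jointly in `(t, x)`, `L`-periodic velocity and pressure; adaptation caveat bounded
domain → periodic cylinder as in that fact). The conclusion is the statement formerly carried by
the named fact `KatoLai1984_periodicCylinderSmoothExistence`, here derived from the uniform-time
fact instead of being assumed: a globally smooth datum is smooth on the closed cylinder and has
finite `H³` norm `M` on the period cell (`eSobolevDomainNorm_cylinderCell_lt_top`), and the
uniform-time fact for the bound `M` launches the required solution on `[0, T₁(L, M))` (the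
printed theorem serves every `H^s_σ` datum, the uniformity of `T` in `Φ_{s₀}` being extra
information). [cite: KatoLai1984, Thm I and Thm II (p. 17)]
[cite: Ferrari1993, Thm 1 (p. 279)] -/
theorem KatoLai1984_periodicCylinderSmoothExistence_of_uniformExistence
    (hE : KatoLai1984_periodicCylinderUniformExistence) :
    ∀ (L : ℝ) (_hL : 0 < L) (u₀ : EuclideanSpace ℝ (Fin 3) → EuclideanSpace ℝ (Fin 3))
      (_hsmooth : ContDiff ℝ ∞ u₀) (_hper : IsAxiallyPeriodic L u₀)
      (_hdiv : ∀ x ∈ (unitCylinder : Set (EuclideanSpace ℝ (Fin 3))),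
        VectorCalculus.divergence u₀ x = 0)
      (_hslip : ∀ x ∈ frontier (unitCylinder : Set (EuclideanSpace ℝ (Fin 3))), ⟪u₀ x, eR x⟫ = 0),
      ∃ T : ℝ, 0 < T ∧ ∃ (u : ℝ → EuclideanSpace ℝ (Fin 3) → EuclideanSpace ℝ (Fin 3))
        (p : ℝ → EuclideanSpace ℝ (Fin 3) → ℝ),
        IsPeriodicCylinderEulerSolution L (Ico 0 T) u₀ u p := by
  intro L hL u₀ hsmooth hper hdiv hslip
  have hsm : ContDiffOn ℝ ∞ u₀ (closure (unitCylinder : Set (EuclideanSpace ℝ (Fin 3)))) :=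
    hsmooth.contDiffOn
  have hfin : eSobolevDomainNorm 3 2 (cylinderCell L) volume u₀ < ⊤ :=
    eSobolevDomainNorm_cylinderCell_lt_top L 3 2 hsm
  obtain ⟨T₁, hT₁, hex⟩ := hE L hL (eSobolevDomainNorm 3 2 (cylinderCell L) volume u₀).toNNReal
  obtain ⟨u, p, hsol⟩ := hex u₀ hsm hper hdiv hslip (ENNReal.coe_toNNReal hfin.ne).ge
  exact ⟨T₁, hT₁, u, p, hsol⟩

/-- **Local existence of smooth axisymmetric Euler flows in the periodic cylinder from the
uniform-time fact alone** (Kato–Lai 1984, Thm I/II, p. 17, with the uniqueness clause of Thm I for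
the propagation of axisymmetry; Ferrari 1993, Thm 1, p. 279): a smooth axisymmetric velocity
field `u₀` on `ℝ³`, `L`-periodic in `z` (`L > 0`), divergence free in `{r < 1}` and tangential on
`{r = 1}`, launches for some `T > 0` a solution of the axisymmetric class
`IsCylinderEulerSolution L [0, T) u₀` of `ChenHouContinuationProofs.lean` (classical Euler solution
in `{r < 1}` with the slip condition, `u(0) = u₀`, `C^∞` up to the boundary jointly in `(t, x)`,
axisymmetric, `L`-periodic velocity and pressure). The conclusion is the statement formerly
carried by the named fact `KatoLai1984_periodicCylinderLocalExistence` — the local-existence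
hypothesis of `Ferrari1993_periodicCylinderEulerBKM_of_localExistence_of_continuation` — here
derived from the uniform-time fact instead of being assumed: compose
`KatoLai1984_periodicCylinderSmoothExistence_of_uniformExistence` with
`KatoLai1984_periodicCylinderLocalExistence_of_existence_of_uniqueness` (axisymmetry of the
solution from the uniqueness clause of Thm I, discharged as
`KatoLai1984_periodicCylinderUniqueness_holds`). [cite: KatoLai1984, Thm I and Thm II (p. 17), with the uniqueness clause of Thm I]
[cite: Ferrari1993, Thm 1 (p. 279)] -/
theorem KatoLai1984_periodicCylinderLocalExistence_of_uniformExistence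
    (hE : KatoLai1984_periodicCylinderUniformExistence) :
    ∀ (L : ℝ) (_hL : 0 < L) (u₀ : EuclideanSpace ℝ (Fin 3) → EuclideanSpace ℝ (Fin 3))
      (_hsmooth : ContDiff ℝ ∞ u₀) (_haxi : IsAxisymmetric u₀) (_hper : IsAxiallyPeriodic L u₀)
      (_hdiv : ∀ x ∈ (unitCylinder : Set (EuclideanSpace ℝ (Fin 3))),
        VectorCalculus.divergence u₀ x = 0)
      (_hslip : ∀ x ∈ frontier (unitCylinder : Set (EuclideanSpace ℝ (Fin 3))), ⟪u₀ x, eR x⟫ = 0),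
      ∃ T : ℝ, 0 < T ∧ ∃ (u : ℝ → EuclideanSpace ℝ (Fin 3) → EuclideanSpace ℝ (Fin 3))
        (p : ℝ → EuclideanSpace ℝ (Fin 3) → ℝ),
        IsCylinderEulerSolution L (Ico 0 T) u₀ u p :=
  KatoLai1984_periodicCylinderLocalExistence_of_existence_of_uniqueness
    (KatoLai1984_periodicCylinderSmoothExistence_of_uniformExistence hE)
    KatoLai1984_periodicCylinderUniqueness_holds

/-- **Uniform local existence in the symmetric class from the uniform-time fact alone**
(`KatoLai1984_periodicCylinderUniformExistence.cylinderEulerSolution` with the uniqueness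
hypothesis discharged by `KatoLai1984_periodicCylinderUniqueness_holds`). [cite: KatoLai1984, Thm I and Thm II (p. 17)] -/
theorem KatoLai1984_periodicCylinderUniformExistence.cylinderEulerSolution'
    (hE : KatoLai1984_periodicCylinderUniformExistence) {L : ℝ} (hL : 0 < L) (M : ℝ≥0) :
    ∃ T₁ : ℝ, 0 < T₁ ∧
      ∀ (φ : EuclideanSpace ℝ (Fin 3) → EuclideanSpace ℝ (Fin 3))
        (_hsmooth : ContDiffOn ℝ ∞ φ (closure (unitCylinder : Set (EuclideanSpace ℝ (Fin 3)))))
        (_haxi : IsAxisymmetric φ) (_hper : IsAxiallyPeriodic L φ)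
        (_hdiv : ∀ x ∈ (unitCylinder : Set (EuclideanSpace ℝ (Fin 3))),
          VectorCalculus.divergence φ x = 0)
        (_hslip : ∀ x ∈ frontier (unitCylinder : Set (EuclideanSpace ℝ (Fin 3))),
          ⟪φ x, eR x⟫ = 0)
        (_hM : FunctionSpaces.eSobolevDomainNorm 3 2 (cylinderCell L) volume φ ≤ M),
        ∃ (u : ℝ → EuclideanSpace ℝ (Fin 3) → EuclideanSpace ℝ (Fin 3))
          (p : ℝ → EuclideanSpace ℝ (Fin 3) → ℝ), IsCylinderEulerSolution L (Ico 0 T₁) φ u p :=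
  hE.cylinderEulerSolution KatoLai1984_periodicCylinderUniqueness_holds hL M

/-! ### The BKM chain in the periodic cylinder on the two remaining analytic facts -/

/-- **Continuation past a time of bounded vorticity from the a-priori `H³` bound and the
uniform-time existence** (`Ferrari1993_periodicCylinderContinuation_of_parts` with the uniqueness
hypothesis discharged by `KatoLai1984_periodicCylinderUniqueness_holds`): Ferrari 1993, proof of
Thm 2, pp. 282–283. [cite: Ferrari1993, Thm 2 (p. 279) and its proof pp. 282–283] -/
theorem Ferrari1993_periodicCylinderContinuation_of_H3Bound_of_uniformExistence
    (hA : Ferrari1993_periodicCylinderH3Bound)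
    (hE : KatoLai1984_periodicCylinderUniformExistence) :
    Ferrari1993_periodicCylinderContinuation :=
  Ferrari1993_periodicCylinderContinuation_of_parts hA hE
    KatoLai1984_periodicCylinderUniqueness_holds

/-- **The BKM criterion in the periodic cylinder (`Ferrari1993_periodicCylinderEulerBKM`) from
the a-priori `H³` bound and the uniform-time existence**: local existence in the symmetric class
(`KatoLai1984_periodicCylinderLocalExistence_of_uniformExistence`) and continuation
(`Ferrari1993_periodicCylinderContinuation_of_H3Bound_of_uniformExistence`) fed into
`Ferrari1993_periodicCylinderEulerBKM_of_localExistence_of_continuation` (Ferrari 1993, Thms 1–2,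
p. 279; Kato–Lai 1984, Thm I/II). Trust base: `Ferrari1993_periodicCylinderH3Bound`,
`KatoLai1984_periodicCylinderUniformExistence`. [cite: Ferrari1993, Thm 2 (p. 279)] -/
theorem Ferrari1993_periodicCylinderEulerBKM_of_H3Bound_of_uniformExistence
    (hA : Ferrari1993_periodicCylinderH3Bound)
    (hE : KatoLai1984_periodicCylinderUniformExistence) : Ferrari1993_periodicCylinderEulerBKM :=
  Ferrari1993_periodicCylinderEulerBKM_of_localExistence_of_continuation
    (KatoLai1984_periodicCylinderLocalExistence_of_uniformExistence hE)
    (Ferrari1993_periodicCylinderContinuation_of_H3Bound_of_uniformExistence hA hE)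

/-- **The Chen–Hou blow-up (`chen_hou_blowup`, ns.S29 (ii)) on three named facts**: the a-priori
`H³` bound, the uniform-time existence, and Chen–Hou's a-priori blow-up estimates
(`chen_hou_blowup_of_localExistence_of_continuation` with local existence and continuation
derived as above). Trust base of a dependent: `Ferrari1993_periodicCylinderH3Bound`,
`KatoLai1984_periodicCylinderUniformExistence`, `ChenHou2022_aprioriBlowupEstimates`. [cite: arXiv221007191, §1 Theorem 2 (p. 3) and §6.1 Theorem 4 (p. 54)] -/
theorem chen_hou_blowup_of_H3Bound_of_uniformExistence
    (hA : Ferrari1993_periodicCylinderH3Bound)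
    (hE : KatoLai1984_periodicCylinderUniformExistence)
    (hCH : ChenHou2022_aprioriBlowupEstimates) : chen_hou_blowup :=
  chen_hou_blowup_of_localExistence_of_continuation
    (KatoLai1984_periodicCylinderLocalExistence_of_uniformExistence hE)
    (Ferrari1993_periodicCylinderContinuation_of_H3Bound_of_uniformExistence hA hE) hCH

end Literature.Analysis.FluidPDE
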